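import Literature.NumberTheory.LFunctions.Zhang2022.KnifeEdgeBandWidth

/-!
# Zhang (2022), rung F-S3 (Landau–Siegel programme, family B-multi, class M3 «non-smooth at the wall»):
# registry rows E-005 «E*-band» and E-034 «E-multi-band(b)» typed over the skeleton — wall/band data, the
# band functional `K[b]`, the band asymptotic as a bare `Prop`, and its positivity bookkeeping PROVED

Y. Zhang, *Discrete mean estimates and the Landau–Siegel zero*, arXiv:2211.02515v1 [Zhang2022LandauSiegel] —
an unrefereed manuscript under adjudication. **WHAT THIS IS NOT: not a claim about Theorems 1–2 of
arXiv:2211.02515, about Landau–Siegel zeros, or about Parity. The programme SEARCHES and TYPES; nothing here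
asserts any estimate: `EMultiBand`, `EStarBand`, `EMultiBandCloses`, `WallCrossCS`, `WallCrossNeg` are bare
`Prop`s (registry rows E-005 / E-034 / E-035 of the cell's `obj/EDREGISTRY.md`, status «derivation (HEURISTIC)»
resp. «derivation not started»), the functional `bandK` is the HEURISTIC continuum dictionary of the dual-sum law
below (a definition, not a theorem about the discrete mean), and every `theorem` is bookkeeping between these
`Prop`s, the definitions, and the named nodes of `SkeletonPropositions`.**

**The design class (OBJECTIVE.md §1.3 (O1); B-multi/PLAN.md M3; B-multi/EDLIST.md v1 rows E-005, multi-E4).**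
A WALL DESIGN is an in-class kinked `H¹` piece `u` on `[0,1]` (`Repair.KinkedProfile u u'`; wall value
`h⁻ = u(1)` free) continued ACROSS the wall `z = 1` by a band piece of height `h⁺` and shape `b` in the band
coordinate `w = (z − 1)/α̃ ∈ (0,1]`, `α̃ = log(Dt₀)/log P = Skeleton.alphaTilde D` ((2.30); the band
`z ∈ (1, 1+α̃]` is exactly where the dual sums of the functional equation of `L(s,χξ)`, conductor `pD`, live:
stationary points `n_m = pD|s|/(2πm)`, `m = 1, 2, …`; beyond `1 + α̃` every profile is invisible —
`KnifeEdgeInvisibleTail.tailInvisible`, `KnifeEdgeDiscMeanFlat.discMeanFlat`, and for rough pieces registry row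
E-033), realised at modulus `D` as the profile `wallProfile ρ (α̃ D) u W` of logarithmic length `1 + α̃(D)`
(Part 1; `ρ` an amplitude normaliser, see «readings» below). Data: `WallData = (h⁺, b)` with `b(0) = 1`
(definition request D-multi-1 of the EDLIST).

**The law being typed (registry E-005, FEASIBILITY.md v1.0b §0.6 «The band», nearmiss CARD-edge-invisibility §1/§5
`EdgeTermLaw`, toy-verified to 1–5 %; HEURISTIC).** In the `ψ (mod p)` family the band is seen only through the
AP-variance of the overhang, and for a band FLAT at height `h` that variance is
`V ≈ |h|²·Σ_{m ≤ D|s|/2π, (m,D)=1} 1/m`; resolving the band profile term by term of the dual sum (the `m`-th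
dual term samples the profile at `w_m = 1 − log m/log(D|s|/2π)`) gives the PROFILE-RESOLVED law of row E-034:
`V ≈ |h⁺|²·K_{D,x}[b]`, `K_{D,x}[b] = Σ_{m ≤ x, (m,D)=1} |b(w_m)|²/m`, `x = D|s|/2π` (`bandKSum`; at `b ≡ 1` it IS
the E-005 sum, `bandKSum_const`), whose continuum form is `(φ(D)/D)·log x·∫₀¹|b(w)|²dw` (`dm/m = log x·dw`):
the normalised BAND FUNCTIONAL `bandK b = ∫₀¹ ‖b(w)‖² dw ≥ 0` (`bandK_nonneg`; `bandK 𝟙 = 1`, `bandK (1 − w) = 1/3`).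
Both the term-by-term resolution and the continuum dictionary are DERIVATION CLAIMS of row E-034 (status
«derivation (HEURISTIC until derived)»), recorded here as definitions so that the evaluator's `wall:K_b` has a
typed meaning; the typed asymptotic `EMultiBand` keeps the band functional as a PARAMETER `K`, exactly as
`KnifeEdgeEStarLen.EStarLen` keeps the off-diagonal form `O`.

**The three readings of the band SCALE (the registry's «unit systems to reconcile»; every line HEURISTIC except
the E-004 statement shape, which is the bare `Prop` `KnifeEdge.BandWidthBound` of `KnifeEdgeBandWidth.lean`):**

| reading | what the band of a profile contributes to the discrete mean `Ξ(H_g,H_g)` | source |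
|---|---|---|
| width (E-004, wall-VANISHING smooth pieces) | `≤ C·α̃(D)·discWeight` — trivial scale `discWeight = Σ|Re 𝔠* Re ω|`, no `𝔞`; `α̃(D) → 0` (`alphaTilde_lt_eventually`) kills it | `KnifeEdge.BandWidthBound` (transfer card `DiscMeanUpperWidth`) |
| wall value `h ≠ 0`, LITERAL (`ρ = 1`) | `|h|²·K[b]·Λ_B(D,χ)·𝔞𝔓` with `Λ_B ≍ 𝓛^{1.1}/(𝔞𝓛⁻⁹) = 𝓛^{10.1}/𝔞 → ∞`: a wall value enters at the TRIVIAL scale `h²𝓛^{1.1}` while the regular main terms are dipole-suppressed, `≍ 𝔞𝓛⁻⁹` of it — «dominant unless `h ≪ 𝔞^{1/2}𝓛^{−5.05}`», i.e. the literal reading diverges unless `h → 0` | ls-theory (zhang-knife INBOX 11:35:37Z), FEASIBILITY §0.6, EDREGISTRY E-005 |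
| BALANCED (`ρ = Λ_B(D,χ)^{−1/2}`, `h⁺ = c`) | `c²·K[b]·𝔞𝔓`: the band is a main-order, SIGN-`+` addition `M_E^{232} = c²K[b]` to `𝔅(u)`, and the completed constant is `𝔅(u) + 2Re X + c²K[b] ≥ (√𝔅(u) − c√K[b])² ≥ 0` whenever the cross term is Cauchy–Schwarz-subordinate (`sq_sqrt_sub_sqrt_le`) | B-multi/EDLIST.md v1 multi-E4, PLAN.md §1 M3 certificate |

**Contents.** Part 1 — D-multi-1: `WallData`, `wallProfile` (+ `flat`, `ramp`, `sharpCut` instances and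
unfolding lemmas). Part 2 — `bandK`, `bandKSum` with `bandK_nonneg`, `bandK_const`, `bandK_ramp`,
`bandKSum_nonneg`, `bandKSum_const` (PROVED). Part 3 — the statements: `EMultiBand c' K Λ X` (E-034: under (A)
the discrete mean of the realised wall design has main term `(𝔅(u) + 2Re X(u,W) + |h⁺|²K[b])·𝔞𝔓`, band height
realised with the normaliser `Λ(D,χ)^{−1/2}`; `X` = the bulk × band cross slot, registry E-006, expected `o(1)`),
`EStarBand c' Λ X` (E-005 = the flat-band instance; `eStarBand_of_eMultiBand`), the decision statement
`EMultiBandCloses K X`, the cross-term shapes `WallCrossCS K X` («`|X|² ≤ 𝔅(u)·V`», the (B1) form of E-006 at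
main-term level, ls-ref-1 16:48:04Z) and `WallCrossNeg κ K X` (registry E-035 «E-cross-neg(κ)»: `2Re X ≤ −κ𝔅(u)`
at saturation `V = 𝔅(u)`). Part 4 — PROVED: the POS endgame for design FAMILIES
`eventually_not_assumptionA_of_negative_mainTerm_family` and `theorem1_of_eMultiBand` (E-034 + its closing +
Prop. 2.2 (i) + Lemma 2.3 ⇒ Theorem 1, by positivity alone — the family version of `KnifeEdge.theorem1_of_eStarLen`);
the M3 certificate `sq_sqrt_sub_sqrt_le`, `wallMainTerm_nonneg_of_cs`, `not_eMultiBandCloses_of_cs` (no wall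
design closes while the cross term is CS-subordinate and `K ≥ 0` — the registry's «no» word for M3 absent E-035),
and `eMultiBandCloses_of_crossNeg` (E-035 with `κ > 2` on a design with `𝔅(u) > 0` closes — the ONLY typed road to
«candidate» for M3, priced XL). **Deliberately NOT here:** any derivation of `K`, `Λ_B` or `X` from Prop 7.1 (rows
E-034/E-005/E-006 stay «derivation»); interior jumps (E-028, `jumpKappa`, typer-2's file); the far-jump invisibility
E-033; the Λ-class block E-030; the in-print Kloosterman correlation bounds behind E-006 (landed separately:
`Lit.fouvryKowalskiMichel2014_theorem117_typeII/…`, `BilinearKloostermanSumsPrimeModulus.lean`, p456463;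
`TraceWeightsOverPrimes.lean`, p456288).
References: Zhang, arXiv:2211.02515v1, §2 (2.14)–(2.20), (2.30), (2.31), Lemma 2.3, Prop. 2.2; §7 Prop 7.1 (7.2);
§8 (8.3), Lemma 8.1 [cite: Zhang2022LandauSiegel, §2 (2.30), §7 Prop 7.1 (7.2), §8 Lemma 8.1]; cell files
OBJECTIVE.md §1.3/§2.2/§3.3, obj/EDREGISTRY.md rows E-004/E-005/E-006/E-034/E-035, B-multi/PLAN.md, EDLIST.md v1,
zhang-knife FEASIBILITY.md v1.0b §0.6, nearmiss CARD-edge-invisibility.md §1/§5 + Sketch.lean §3 (`EdgeTermLaw`).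
«The programme SEARCHES and TYPES; no claim about Landau–Siegel zeros, Theorems 1–2 of arXiv:2211.02515 or a
repaired Margin232 until a kernel theorem says so.»
-/

noncomputable section

open Complex Real Set
open _root_.MeasureTheory

namespace Literature.NumberTheory.LFunctions.Zhang2022

namespace KnifeEdge

open Repair Skeleton

/-! ### Part 1 — D-multi-1: wall/band data and the realised profile of a wall design -/

/-- **Wall/band data** (definition request D-multi-1 of B-multi/EDLIST.md v1; OBJECTIVE.md §1.4 design key
`wall {h_plus, band_profile on w ∈ [0,1]}`): the height `h⁺ = g(1⁺)` with which a design crosses the wall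
`z = 1` and the SHAPE `b` of its band piece in the band coordinate `w = (z − 1)/α̃ ∈ [0,1]`, normalised by
`b(0) = 1` (so that the profile just beyond the wall is `h⁺`), measurable and bounded on `[0,1]` (every PPE
profile is). The wall value from the left, `h⁻ = u(1)`, is carried by the in-class piece `u` itself.
[cite: Zhang2022LandauSiegel, §2 (2.30), §7 Prop 7.1 (7.2)] -/
structure WallData where
  /-- the wall height `h⁺ = g(1⁺)` -/
  hPlus : ℂ
  /-- the band shape in the coordinate `w = (z − 1)/α̃` -/
  band : ℝ → ℂ
  band_zero : band 0 = 1
  band_measurable : Measurable band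
  band_bdd : ∃ B : ℝ, ∀ w ∈ Icc (0:ℝ) 1, ‖band w‖ ≤ B

namespace WallData

/-- The FLAT band at height `h` (`b ≡ 1`: the profile continues at its wall value through the whole band —
the configuration of the E-005 law / nearmiss `EdgeTermLaw`). [cite: Zhang2022LandauSiegel, §2 (2.30)] -/
def flat (h : ℂ) : WallData where
  hPlus := h
  band := fun _ => 1
  band_zero := rfl
  band_measurable := measurable_const
  band_bdd := ⟨1, fun _ _ => by simp⟩

/-- The RAMP band at height `h` (`b(w) = 1 − w`: linear decay to `0` at the far end of the band, `K = 1/3`).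
[cite: Zhang2022LandauSiegel, §2 (2.30)] -/
def ramp (h : ℂ) : WallData where
  hPlus := h
  band := fun w => ((1 - w : ℝ) : ℂ)
  band_zero := by simp
  band_measurable := by fun_prop
  band_bdd := ⟨1, fun w hw => by
    rw [Complex.norm_real, Real.norm_eq_abs, abs_le]
    constructor <;> linarith [hw.1, hw.2]⟩

/-- The SHARP CUT at the wall (`h⁺ = 0`: nothing beyond `z = 1`; the wall value `h⁻ = u(1)` may still be
`≠ 0` — by ls-theory's A(16:38:24Z Q→theory-2) the penalty-free cut is at the (7.2) wall `1 − 2τ_T`, inside class).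
[cite: Zhang2022LandauSiegel, §7 Prop 7.1 (7.2)] -/
def sharpCut : WallData := flat 0

/-- The flat band's height is `h`. [cite: Zhang2022LandauSiegel, §2 (2.30)] -/
@[simp] theorem flat_hPlus (h : ℂ) : (flat h).hPlus = h := rfl

/-- The flat band's shape is `≡ 1`. [cite: Zhang2022LandauSiegel, §2 (2.30)] -/
@[simp] theorem flat_band (h : ℂ) (w : ℝ) : (flat h).band w = 1 := rfl

/-- The ramp band's height is `h`. [cite: Zhang2022LandauSiegel, §2 (2.30)] -/
@[simp] theorem ramp_hPlus (h : ℂ) : (ramp h).hPlus = h := rfl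

/-- The ramp band's shape is `1 − w`. [cite: Zhang2022LandauSiegel, §2 (2.30)] -/
@[simp] theorem ramp_band (h : ℂ) (w : ℝ) : (ramp h).band w = ((1 - w : ℝ) : ℂ) := rfl

/-- The sharp cut has height `0` beyond the wall. [cite: Zhang2022LandauSiegel, §7 Prop 7.1 (7.2)] -/
@[simp] theorem sharpCut_hPlus : sharpCut.hPlus = 0 := rfl

end WallData

/-- **The realised profile of a wall design** at band width `α` with amplitude normaliser `ρ`:
`g(z) = u(z)` for `z ≤ 1` (the in-class piece), `g(z) = ρ·h⁺·b((z − 1)/α)` on the band `1 < z ≤ 1 + α`, and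
`g(z) = 0` beyond. At modulus `D` one takes `α = α̃(D)` (`Skeleton.alphaTilde`); `ρ = 1` is the LITERAL reading,
`ρ = Λ_B(D,χ)^{−1/2}` the BALANCED one (module docstring). [cite: Zhang2022LandauSiegel, §2 (2.30), §7 (7.2)] -/
def wallProfile (ρ α : ℝ) (u : ℝ → ℂ) (W : WallData) : ℝ → ℂ := fun z =>
  if z ≤ 1 then u z else if z ≤ 1 + α then (ρ : ℂ) * W.hPlus * W.band ((z - 1) / α) else 0

variable {ρ α : ℝ} {u : ℝ → ℂ} {W : WallData} {z : ℝ}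

/-- Inside the class the realised profile is the in-class piece. [cite: Zhang2022LandauSiegel, §7 (7.2)] -/
theorem wallProfile_of_le_one (hz : z ≤ 1) : wallProfile ρ α u W z = u z := by
  simp [wallProfile, hz]

/-- On the band the realised profile is `ρ·h⁺·b((z−1)/α)`. [cite: Zhang2022LandauSiegel, §2 (2.30)] -/
theorem wallProfile_of_mem_band (h1 : 1 < z) (h2 : z ≤ 1 + α) :
    wallProfile ρ α u W z = (ρ : ℂ) * W.hPlus * W.band ((z - 1) / α) := by
  simp [wallProfile, not_le.mpr h1, h2]

/-- Beyond the band (of width `α ≥ 0`) the realised profile vanishes. [cite: Zhang2022LandauSiegel, §2 (2.30)] -/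
theorem wallProfile_of_gt (hα : 0 ≤ α) (hz : 1 + α < z) : wallProfile ρ α u W z = 0 := by
  have h1 : ¬ z ≤ 1 := not_le.mpr (by linarith)
  have h2 : ¬ z ≤ 1 + α := not_le.mpr hz
  simp [wallProfile, h1, h2]

/-- The sharp cut carries nothing beyond the wall. [cite: Zhang2022LandauSiegel, §7 (7.2)] -/
theorem wallProfile_sharpCut_of_gt (hz : 1 < z) : wallProfile ρ α u WallData.sharpCut z = 0 := by
  unfold wallProfile
  rw [if_neg (not_le.mpr hz)]
  split_ifs <;> simp [WallData.sharpCut]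

/-! ### Part 2 — the band functional `K[b]` (E-034's object) and the dual-sum law it abbreviates -/

/-- **The normalised band functional** `K[b] = ∫₀¹ ‖b(w)‖² dw` — the continuum form of the profile-resolved
dual-sum law `Σ_{m ≤ x, (m,D)=1} |b(1 − log m/log x)|²/m ≈ (φ(D)/D)·log x·K[b]` (HEURISTIC dictionary of row
E-034; `dm/m = log x·dw`). A DEFINITION; that it is the right functional is the derivation claim of E-034.
(`intervalIntegral`; junk value `0` for non-integrable `b` — excluded by `WallData.band_measurable/band_bdd`.)
[cite: Zhang2022LandauSiegel, §2 (2.30), §8 Lemma 8.1] -/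
def bandK (b : ℝ → ℂ) : ℝ := ∫ w in (0:ℝ)..1, ‖b w‖ ^ 2

/-- **The dual-sum law, profile-resolved** (row E-034's discrete object; at `b ≡ c` it is the E-005 /
`EdgeTermLaw` sum `|c|²·Σ_{m ≤ x, (m,D)=1} 1/m`, `bandKSum_const`): `K_{D,x}[b] = Σ_{1 ≤ m ≤ x, (m,D)=1}
‖b(1 − log m/log x)‖²/m`, with `x = D|s|/2π` the dual length and `w_m = 1 − log m/log x` the band position of the
`m`-th dual term (`n_m = pD|s|/(2πm)`). [cite: Zhang2022LandauSiegel, §2 (2.30), §8 Lemma 8.1] -/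
def bandKSum (D : ℕ) (x : ℝ) (b : ℝ → ℂ) : ℝ :=
  ∑ m ∈ (Finset.Icc 1 ⌊x⌋₊).filter (fun m => Nat.Coprime m D),
    ‖b (1 - Real.log m / Real.log x)‖ ^ 2 / m

/-- `K[b] ≥ 0` — the SIGN of the band term ((B1): a variance). [cite: Zhang2022LandauSiegel, §2 Lemma 2.3, (2.15)] -/
theorem bandK_nonneg (b : ℝ → ℂ) : 0 ≤ bandK b :=
  intervalIntegral.integral_nonneg zero_le_one fun _ _ => sq_nonneg _

/-- `K[c·𝟙] = |c|²`; in particular `K[𝟙] = 1` (the flat band of E-005). [cite: Zhang2022LandauSiegel, §2 (2.30)] -/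
theorem bandK_const (c : ℂ) : bandK (fun _ => c) = ‖c‖ ^ 2 := by
  simp [bandK]

/-- `K` of the flat band is `1`. [cite: Zhang2022LandauSiegel, §2 (2.30)] -/
theorem bandK_flat (h : ℂ) : bandK (WallData.flat h).band = 1 := by
  simp [bandK]

/-- `K[1 − w] = 1/3` (the ramp band). [cite: Zhang2022LandauSiegel, §2 (2.30)] -/
theorem bandK_ramp (h : ℂ) : bandK (WallData.ramp h).band = 1 / 3 := by
  have hn : ∀ w : ℝ, ‖((1 - w : ℝ) : ℂ)‖ ^ 2 = (1 - w) ^ 2 := fun w => by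
    rw [Complex.norm_real, Real.norm_eq_abs, sq_abs]
  simp only [bandK, WallData.ramp_band, hn]
  have h := intervalIntegral.integral_comp_sub_left (fun x : ℝ => x ^ 2) (1 : ℝ) (a := 0) (b := 1)
  simp only [sub_self, sub_zero] at h
  rw [h, integral_pow]
  norm_num

/-- `K_{D,x}[b] ≥ 0`. [cite: Zhang2022LandauSiegel, §2 Lemma 2.3, (2.15)] -/
theorem bandKSum_nonneg (D : ℕ) (x : ℝ) (b : ℝ → ℂ) : 0 ≤ bandKSum D x b :=
  Finset.sum_nonneg fun m _ => by positivity

/-- **At a flat band the profile-resolved law IS the E-005 law:** `K_{D,x}[c·𝟙] = |c|²·Σ_{m ≤ x,(m,D)=1} 1/m`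
(the sum of nearmiss `EdgeTermLaw` at `x = D|s|/2π`). [cite: Zhang2022LandauSiegel, §2 (2.30), §8 Lemma 8.1] -/
theorem bandKSum_const (D : ℕ) (x : ℝ) (c : ℂ) :
    bandKSum D x (fun _ => c) =
      ‖c‖ ^ 2 * ∑ m ∈ (Finset.Icc 1 ⌊x⌋₊).filter (fun m => Nat.Coprime m D), (1 : ℝ) / m := by
  rw [bandKSum, Finset.mul_sum]
  exact Finset.sum_congr rfl fun m _ => by ring

/-! ### Part 3 — registry rows E-005 / E-034 / E-035 as bare `Prop`s (none asserted) -/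

/-- The band SCALE `Λ_B(D,χ)` — a parameter (HEURISTIC identification `Λ_B ≍ 𝓛^{10.1}/𝔞`, module docstring);
the balanced reading realises the band height as `h⁺·Λ_B(D,χ)^{−1/2}`, the literal one is `Λ ≡ 1`.
[cite: Zhang2022LandauSiegel, §2 (2.30), (2.31)] -/
abbrev BandScale : Type := (D : ℕ) → DirichletCharacter ℂ D → ℝ

/-- The bulk × band CROSS slot at main-term level (registry E-006's object for a wall design: a functional of
the in-class piece and the wall data; expected `o(1)`, nearest print the Kloosterman correlation bounds of
`BilinearKloostermanSumsPrimeModulus.lean` / `TraceWeightsOverPrimes.lean`). [cite: Zhang2022LandauSiegel, §8 Lemma 8.1] -/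
abbrev WallCross : Type := (ℝ → ℂ) → (ℝ → ℂ) → WallData → ℂ

/-- **The completed main-order constant of a wall design** (balanced reading):
`𝔅(u) + 2Re X(u,W) + |h⁺|²·K[b]` — in-class block (`mainTermForm`), cross slot, band variance.
[cite: Zhang2022LandauSiegel, §7 Prop 7.1 (7.2), §8 Lemma 8.1] -/
def wallMainTerm (K : (ℝ → ℂ) → ℝ) (X : WallCross) (u u' : ℝ → ℂ) (W : WallData) : ℝ :=
  mainTermForm u u' + 2 * (X u u' W).re + ‖W.hPlus‖ ^ 2 * K W.band

/-- **E-034 «E-multi-band(b)» (⊇ E-005) — the band asymptotic, balanced reading, band functional `K`, band scale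
`Λ`, cross slot `X` as PARAMETERS** (status: derivation, HEURISTIC; would NOT close anything if proved with
`K ≥ 0` and a CS-subordinate `X` — `not_eMultiBandCloses_of_cs`): under (A), for every in-class kinked piece `u`
and every wall/band data `W`, the discrete mean of the profile polynomial of the realised design
`wallProfile (Λ(D,χ)^{−1/2}) (α̃ D) u W` of length `⌈P^{1+α̃(D)}⌉` equals `wallMainTerm K X u u' W·𝔞𝔓 + o(𝔞𝔓)`
— the `ForAllLarge … AssumptionA D χ → |mean − main·𝔞𝔓| ≤ ε𝔞𝔓` shape of `KnifeEdge.EStarLen` / `Skeleton.Eval823`.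
TODO(class): a derivation may deliver it only for PPE / bounded-variation band shapes; the quantifier over all
`WallData` (measurable, bounded on `[0,1]`) is the typed default. [cite: Zhang2022LandauSiegel, §7 Prop 7.1 (7.2), §8 (8.3), Lemma 8.1] -/
def EMultiBand (c' : ℝ) (K : (ℝ → ℂ) → ℝ) (Λ : BandScale) (X : WallCross) : Prop :=
  ∀ (u u' : ℝ → ℂ), KinkedProfile u u' → ∀ (W : WallData) (ε : ℝ), 0 < ε →
    ForAllLarge fun D _ χ => AssumptionA D χ →
      |discMean c' χ (fun x s =>
            profPoly χ x (wallProfile ((Λ D χ) ^ (-(1 / 2 : ℝ))) (alphaTilde D) u W)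
              ⌈bigP D ^ (1 + alphaTilde D)⌉₊ s)
          - wallMainTerm K X u u' W * frakA χ * frakP D| ≤ ε * frakA χ * frakP D

/-- **E-005 «E*-band» — the flat-band instance** (the nearmiss law `V ≈ |h|²Σ_{m ≤ D|s|/2π,(m,D)=1} 1/m` in the
balanced reading, `K[𝟙]` absorbed in `Λ`): under (A), a kinked piece `u` continued FLAT at height
`h·Λ(D,χ)^{−1/2}` through the band has discrete mean `(𝔅(u) + 2Re X(u, flat h) + |h|²)·𝔞𝔓 + o(𝔞𝔓)`.
Status: derivation (HEURISTIC, toy-verified 1–5 % in the literal reading); sign `+` ((B1)).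
[cite: Zhang2022LandauSiegel, §7 Prop 7.1 (7.2), §8 Lemma 8.1] -/
def EStarBand (c' : ℝ) (Λ : BandScale) (X : WallCross) : Prop :=
  ∀ (u u' : ℝ → ℂ), KinkedProfile u u' → ∀ (h : ℂ) (ε : ℝ), 0 < ε →
    ForAllLarge fun D _ χ => AssumptionA D χ →
      |discMean c' χ (fun x s =>
            profPoly χ x (wallProfile ((Λ D χ) ^ (-(1 / 2 : ℝ))) (alphaTilde D) u (WallData.flat h))
              ⌈bigP D ^ (1 + alphaTilde D)⌉₊ s)
          - (mainTermForm u u' + 2 * (X u u' (WallData.flat h)).re + ‖h‖ ^ 2) * frakA χ * frakP D|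
        ≤ ε * frakA χ * frakP D

/-- **E-034 CLOSES — the decision statement** (the M3 «candidate» word): some wall design has a NEGATIVE
completed constant `𝔅(u) + 2Re X(u,W) + |h⁺|²K[b] < 0`. With `K ≥ 0` this needs a negative cross term beyond
Cauchy–Schwarz (E-035); the (B1) prediction is `¬ EMultiBandCloses K X` (`not_eMultiBandCloses_of_cs`).
[cite: Zhang2022LandauSiegel, §7 Prop 7.1 (7.2)] -/
def EMultiBandCloses (K : (ℝ → ℂ) → ℝ) (X : WallCross) : Prop :=
  ∃ (u u' : ℝ → ℂ) (W : WallData), KinkedProfile u u' ∧ wallMainTerm K X u u' W < 0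

/-- **E-006 at main-term level, (B1) shape «|cross|² ≤ 𝔅(u)·V»** (ls-ref-1 16:48:04Z: «the (bulk, band) 2×2 block
of a PSD form is PSD»): the cross slot is Cauchy–Schwarz-subordinate to the in-class block and the band variance
on every wall design. Status: derivation (expected; the registry's E-006 even predicts `X = o(1)`).
[cite: Zhang2022LandauSiegel, §2 Lemma 2.3, (2.15), §8 Lemma 8.1] -/
def WallCrossCS (K : (ℝ → ℂ) → ℝ) (X : WallCross) : Prop :=
  ∀ (u u' : ℝ → ℂ) (W : WallData), KinkedProfile u u' →
    ‖X u u' W‖ ^ 2 ≤ mainTermForm u u' * (‖W.hPlus‖ ^ 2 * K W.band)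

/-- **E-035 «E-cross-neg(κ)» — the shape of the ONLY input under which M3 could read «candidate»** (registry
v1.8, opened 16:48:50Z; status derivation not started; price XL, «(B1)-excluded at main order»): some wall design
at band SATURATION `|h⁺|²K[b] = 𝔅(u) > 0` has cross term `2Re X(u,W) ≤ −κ·𝔅(u)`. For `κ > 2` it closes
(`eMultiBandCloses_of_crossNeg`); `κ ≤ 2` is compatible with Cauchy–Schwarz. [cite: Zhang2022LandauSiegel, §8 Lemma 8.1] -/
def WallCrossNeg (κ : ℝ) (K : (ℝ → ℂ) → ℝ) (X : WallCross) : Prop :=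
  ∃ (u u' : ℝ → ℂ) (W : WallData), KinkedProfile u u' ∧ 0 < mainTermForm u u' ∧
    ‖W.hPlus‖ ^ 2 * K W.band = mainTermForm u u' ∧ 2 * (X u u' W).re ≤ -κ * mainTermForm u u'

/-! ### Part 4 — PROVED: the positivity endgame for design families, and the M3 certificate -/

section Endgame

/-- **THE POSITIVITY ENDGAME for a FAMILY of value tables** (the family version of
`KnifeEdge.eventually_not_assumptionA_of_negative_mainTerm`, whose profile was fixed; here the values
`F D χ : Chr D → ℂ → ℂ` may depend on the modulus and the character, as a realised wall design does): if under
(A) the discrete mean of `F D χ` has main term `m·𝔞𝔓 + o(𝔞𝔓)` with `m < 0`, then Prop. 2.2 (i) and Lemma 2.3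
(every discrete mean `≥ 0`, `discMean_nonneg`) make (A) fail for every real primitive character to every large
modulus (`𝔞 ≥ a₀ > 0`: `frakALowerBound_holds`; `𝔓 > 0`: `frakP_eventually_pos`).
[cite: Zhang2022LandauSiegel, §2 p. 6, Lemma 2.3, Prop. 2.2 (i), (2.15)] -/
theorem eventually_not_assumptionA_of_negative_mainTerm_family {c' m : ℝ} (hm : m < 0)
    {F : (D : ℕ) → DirichletCharacter ℂ D → (Chr D → ℂ → ℂ)}
    (hasymp : ∀ ε : ℝ, 0 < ε → ForAllLarge fun D _ χ => AssumptionA D χ →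
      |discMean c' χ (F D χ) - m * frakA χ * frakP D| ≤ ε * frakA χ * frakP D)
    (h22 : Prop22i) (h23 : Lemma23 c') :
    ∃ D₀ : ℕ, ∀ (D : ℕ) [NeZero D] (χ : DirichletCharacter ℂ D),
      D₀ ≤ D → χ.IsQuadratic → χ.IsPrimitive → ¬ AssumptionA D χ := by
  have hε : 0 < -m / 2 := by linarith
  obtain ⟨D₁, h₁⟩ := ((hasymp (-m / 2) hε).and h22).and h23
  obtain ⟨a₀, ha₀, D₂, h₂⟩ := frakALowerBound_holds
  obtain ⟨D₃, h₃⟩ := frakP_eventually_pos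
  refine ⟨max (max D₁ D₂) (max D₃ 3), fun D _ χ hD hq hp hA => ?_⟩
  have hD₁ : D₁ ≤ D := le_trans (le_trans (le_max_left _ _) (le_max_left _ _)) hD
  have hD₂ : D₂ ≤ D := le_trans (le_trans (le_max_right _ _) (le_max_left _ _)) hD
  have hD₃ : D₃ ≤ D := le_trans (le_trans (le_max_left _ _) (le_max_right _ _)) hD
  have hD3 : 3 ≤ D := le_trans (le_trans (le_max_right _ _) (le_max_right _ _)) hD
  obtain ⟨⟨hmean, h22'⟩, h23'⟩ := h₁ D χ hD₁ hq hp
  have hmean' := hmean hA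
  have hA0 : 0 < frakA χ := lt_of_lt_of_le ha₀ (h₂ D χ hD₂ hq hp hA)
  have hP0 : 0 < frakP D := h₃ D hD₃
  have hw := weights_nonneg_of hD3 h23' h22'
  have hpos := discMean_nonneg hw (F D χ)
  have hX : 0 < frakA χ * frakP D := mul_pos hA0 hP0
  have hup := (abs_le.mp hmean').2
  nlinarith

variable {c' : ℝ} {K : (ℝ → ℂ) → ℝ} {Λ : BandScale} {X : WallCross}

/-- **B-multi's POS endgame for the wall class as a kernel implication: E-034 + its closing + Zhang's Part-1
zero model ⇒ Theorem 1 of the manuscript**, via `SkeletonSetting.theorem1_of_eventually_not_assumptionA`.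
Both `E` hypotheses are OPEN (registry E-034/E-035; prediction B-AH: the closing fails); `Prop22i`, `Lemma23 c'`
are CLAIMS of the manuscript — nothing is asserted. [cite: Zhang2022LandauSiegel, §2 p. 6, §7 Prop 7.1 (7.2)] -/
theorem theorem1_of_eMultiBand (hE : EMultiBand c' K Λ X) (hC : EMultiBandCloses K X) (h22 : Prop22i)
    (h23 : Lemma23 c') : Theorem1 := by
  obtain ⟨u, u', W, hu, hneg⟩ := hC
  exact Skeleton.theorem1_of_eventually_not_assumptionA
    (eventually_not_assumptionA_of_negative_mainTerm_family hneg (hE u u' hu W) h22 h23)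

/-- … and Theorem 2. [cite: Zhang2022LandauSiegel, §1 Theorem 2] -/
theorem theorem2_of_eMultiBand (hE : EMultiBand c' K Λ X) (hC : EMultiBandCloses K X) (h22 : Prop22i)
    (h23 : Lemma23 c') : Theorem2 :=
  Skeleton.theorem2_of_theorem1 (theorem1_of_eMultiBand hE hC h22 h23)

/-- **E-005 is the flat-band instance of E-034** once `K[𝟙] = 1` (e.g. `K = bandK`, `bandK_const`).
[cite: Zhang2022LandauSiegel, §2 (2.30), §8 Lemma 8.1] -/
theorem eStarBand_of_eMultiBand (hK : K (fun _ => (1 : ℂ)) = 1) (hE : EMultiBand c' K Λ X) :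
    EStarBand c' Λ X := by
  intro u u' hu h ε hε
  have h1 := hE u u' hu (WallData.flat h) ε hε
  have hb : (WallData.flat h).band = fun _ => (1 : ℂ) := rfl
  have hmain : wallMainTerm K X u u' (WallData.flat h) =
      mainTermForm u u' + 2 * (X u u' (WallData.flat h)).re + ‖h‖ ^ 2 := by
    rw [wallMainTerm, hb, hK, WallData.flat_hPlus, mul_one]
  simpa only [hmain] using h1

/-- **The M3 certificate (PROVED algebra):** if `𝔅 ≥ 0`, `V ≥ 0` and the cross term is Cauchy–Schwarz-subordinate,
`|X|² ≤ 𝔅·V`, then `(√𝔅 − √V)² ≤ 𝔅 + 2Re X + V` — in particular the completed constant is `≥ 0`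
(B-multi/PLAN.md §1: «OBJ_pos ≥ (√𝔅(u) − c√K)²»). [cite: Zhang2022LandauSiegel, §2 Lemma 2.3, (2.15)] -/
theorem sq_sqrt_sub_sqrt_le {B V : ℝ} {x : ℂ} (hB : 0 ≤ B) (hV : 0 ≤ V) (hx : ‖x‖ ^ 2 ≤ B * V) :
    (Real.sqrt B - Real.sqrt V) ^ 2 ≤ B + 2 * x.re + V := by
  have h1 : |x.re| ≤ ‖x‖ := Complex.abs_re_le_norm x
  have h2 : ‖x‖ ≤ Real.sqrt B * Real.sqrt V := by
    rw [← Real.sqrt_mul hB, ← Real.sqrt_sq (norm_nonneg x)]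
    exact Real.sqrt_le_sqrt hx
  have h3 : (Real.sqrt B - Real.sqrt V) ^ 2 = B - 2 * (Real.sqrt B * Real.sqrt V) + V := by
    rw [sub_sq, Real.sq_sqrt hB, Real.sq_sqrt hV]; ring
  rw [h3]
  have h4 := (abs_le.mp h1).1
  linarith

/-- **No wall design has a negative completed constant while `K ≥ 0` and the cross term is CS-subordinate**
(`𝔅(u) ≥ 0` for every kinked in-class piece: `mainTermForm_nonneg_of_isH1`).
[cite: Zhang2022LandauSiegel, §2 Lemma 2.3, (2.15), §7 Prop 7.1] -/
theorem wallMainTerm_nonneg_of_cs (hK : ∀ b : ℝ → ℂ, 0 ≤ K b) (hX : WallCrossCS K X)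
    {u u' : ℝ → ℂ} (hu : KinkedProfile u u') (W : WallData) : 0 ≤ wallMainTerm K X u u' W := by
  have hB : 0 ≤ mainTermForm u u' := mainTermForm_nonneg_of_isH1 hu.isH1
  have hV : 0 ≤ ‖W.hPlus‖ ^ 2 * K W.band := mul_nonneg (sq_nonneg _) (hK _)
  have h := sq_sqrt_sub_sqrt_le hB hV (hX u u' W hu)
  have h0 : 0 ≤ (Real.sqrt (mainTermForm u u') - Real.sqrt (‖W.hPlus‖ ^ 2 * K W.band)) ^ 2 := sq_nonneg _
  unfold wallMainTerm
  linarith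

/-- **The (B1) prediction as bookkeeping — the registry's «no» word for class M3 absent E-035:** with `K ≥ 0` and a
CS-subordinate cross slot, E-034 never closes. [cite: Zhang2022LandauSiegel, §2 Lemma 2.3, (2.15)] -/
theorem not_eMultiBandCloses_of_cs (hK : ∀ b : ℝ → ℂ, 0 ≤ K b) (hX : WallCrossCS K X) :
    ¬ EMultiBandCloses K X := by
  rintro ⟨u, u', W, hu, hneg⟩
  exact not_lt.2 (wallMainTerm_nonneg_of_cs hK hX hu W) hneg

/-- In particular for the typed band functional `K = bandK`. [cite: Zhang2022LandauSiegel, §2 Lemma 2.3, (2.15)] -/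
theorem not_eMultiBandCloses_bandK_of_cs (hX : WallCrossCS bandK X) : ¬ EMultiBandCloses bandK X :=
  not_eMultiBandCloses_of_cs bandK_nonneg hX

/-- **E-035 with `κ > 2` closes:** at saturation `V = 𝔅(u) > 0` a cross term `2Re X ≤ −κ𝔅(u)` gives the completed
constant `≤ (2 − κ)𝔅(u) < 0` — the only typed road from M3 to «candidate» (priced XL: it negates `WallCrossCS` on
that design, `wallCrossNeg_not_cs`). [cite: Zhang2022LandauSiegel, §8 Lemma 8.1] -/
theorem eMultiBandCloses_of_crossNeg {κ : ℝ} (hκ : 2 < κ) (h : WallCrossNeg κ K X) :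
    EMultiBandCloses K X := by
  obtain ⟨u, u', W, hu, hB, hsat, hcross⟩ := h
  refine ⟨u, u', W, hu, ?_⟩
  rw [wallMainTerm, hsat]
  nlinarith

/-- … hence such a cross term is NOT Cauchy–Schwarz-subordinate (when `K ≥ 0`): E-035 with `κ > 2` is the
negation side of the (B1) block statement. [cite: Zhang2022LandauSiegel, §2 Lemma 2.3, (2.15)] -/
theorem wallCrossNeg_not_cs {κ : ℝ} (hκ : 2 < κ) (hK : ∀ b : ℝ → ℂ, 0 ≤ K b) (h : WallCrossNeg κ K X) :
    ¬ WallCrossCS K X := fun hX =>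
  not_eMultiBandCloses_of_cs hK hX (eMultiBandCloses_of_crossNeg hκ h)

end Endgame

end KnifeEdge

end Literature.NumberTheory.LFunctions.Zhang2022
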